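import Literature.Geometry.Kaehler.ComplexTorusEllipticProductPicardThreeLatticesDecomposable
import HarnessLib

/-!
# The Gram determinant of a lattice of `2`-classes is well defined; Ma's (4.1)
# `N = ½ det(NS_A) = -½ det(T_A)` for EVERY `ℤ`-basis of `NS_X`, `T_X` of a decomposable surface with `ρ = 3`

Layer `Literature/Geometry/Kaehler`, namespace `Literature.Geometry.Kaehler.ComplexTorus`; lane `lit-hodgefound`
(Track 2 foundations library, Layer A1/A4), seat p18 gen 23, row g23-#1 FILE 4c — closes the "Honest scope" item of
FILE 4 `ComplexTorusEllipticProductPicardThreeLattices` / FILE 4b `…LatticesDecomposable` ("that the determinant of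
a Gram matrix does not depend on the `ℤ`-basis (so that `det(T_A)` is intrinsic) is the standard fact, not re-proved
here; the rank-`2` case is `exists_det_gram_of_two_bases`").  THEOREMS ONLY — no definition, no named fact (D-0026; net
Literature debt `0`).

## Source, VERBATIM

S. Ma, *Decompositions of an Abelian surface and quadratic forms*, Ann. Inst. Fourier **61** (2011) 717–743
[Ma2011DecompositionsAbelianSurface] (held text `paper:arxiv-0906.0412`, p0003, p0008): "let `T_A` be the
transcendental lattice of `A`, which is the orthogonal complement of the Néron-Severi lattice in `H²(A, ℤ)`."
"(2) When `ρ(A) = 3`, one has `δ(A) = 2^{τ(N)-1}` where `2N = -det(T_A)`." §4.1: "Then `NS_A ≃ U ⊕ ⟨-2N⟩` for some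
`N ∈ ℤ_{>0}`. This natural number `N` may be calculated by (4.1) `N = ½ det(NS_A) = -½ det(T_A)`. …
**Proposition 4.1.** Let `(E₁, E₂)` be a decomposition of `A`. Then `N = min{deg φ | φ : E₁ → E₂ isogeny}`."
T. Shioda, N. Mitani, LNM **412** (1974) [ShiodaMitani1974], §1: "(1.5) `H²(X, ℤ) × H²(X, ℤ) → H⁴(X, ℤ) = ℤ` …
`H_X` is a Euclidean lattice", (1.6)–(1.8) (the Gram matrix `Q` of a basis of `T_X`), §3 (3.19)–(3.21) (lattices up
to isometry ↔ Gram matrices up to `GL₂(ℤ)`).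

## Dictionary

`X = E/Φ(ℤ^ι)` a two-dimensional complex torus with an ordering `e : Fin 4 ≃ ι` of its lattice basis (the datum of
`∫_X`); the cup product of `2`-classes is `∫_X x ∧ y = torusIntegral Φ e (x.wedge y)`; a `ℤ`-basis of a lattice
`L ⊆ H²(X, ℂ)` (an `AddSubgroup`) is a family `u : κ → H²(X, ℂ)` with `L = {∑ nₖ uₖ | n : κ → ℤ}` (for the REFERENCE
basis also `ℂ`-independence is recorded; a second generating family of the same finite size is then automatically
a basis); the Gram matrix is `Matrix.of fun i j ↦ ∫_X uᵢ ∧ uⱼ` and "`det L`" its determinant.  `NS_X`, `T_X`,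
`ρ(X)`, decompositions and isogeny degrees as in FILES 1–4b.

## Contents (all proved)

* §1 `torusIntegral_sum_smul_wedge_sum_smul` (bilinear expansion of `∫ (∑ aₖtₖ) ∧ (∑ b_l s_l)`),
  **`det_gram_eq_of_two_bases`** — THE GRAM DETERMINANT IS WELL DEFINED: two `ℤ`-bases (same finite index type) of
  a lattice of `2`-classes have Gram matrices `G_u = M G_t ᵗM` with `M ∈ GL(ℤ)`, hence equal determinants (any
  two-dimensional torus, any rank).
* §2 **`det_gram_transcendentalLattice_neronSeveri_of_finrank_eq_three`** — for every decomposable `X ≅ E_{τ₁} × E_{τ₂}`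
  with `ρ(X) = 3`: `∃ N ≥ 1`, the minimal isogeny degree `E_{τ₁} → E_{τ₂}` (Prop. 4.1), with `det(Gram) = -2N` for
  EVERY `ℤ`-basis `u : Fin 3 → T_X` and `det(Gram) = 2N` for EVERY `ℤ`-basis `v : Fin 3 → NS_X` — Ma's (4.1) and the
  "where `2N = -det(T_A)`" of Theorems 1.2 (2), 1.3 (2), independently of the basis (combining FILE 4b's explicit
  bases `U ⊕ ⟨∓2N⟩` with §1).

## Honest scope — NOT here

That every `ℤ`-basis of `T_X` (resp. `NS_X`) is indexed by a type of cardinality `3` (invariance of the rank) is not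
re-proved: §2 quantifies over `Fin 3`-indexed bases.  Signatures and the lattice genus are not discussed.

## References

* [Ma2011DecompositionsAbelianSurface] S. Ma, Ann. Inst. Fourier 61 (2011) = arXiv:0906.0412: §1 Thm. 1.2 (2),
  Thm. 1.3 (2); §4.1 (4.1), Prop. 4.1.
* [ShiodaMitani1974] T. Shioda, N. Mitani, LNM 412 (1974): §1 (1.5)–(1.8), §3 (3.19)–(3.21).
* [Lange2023AbelianVarietiesComplex] H. Lange (2023): §1.1.3 Cor. 1.1.19, §6.2.4 (the integral `∫_X`).
-/

noncomputable section

open Module Complex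

namespace Literature.Geometry.Kaehler

namespace ComplexTorus

/-! ## §1 The Gram determinant of a lattice of `2`-classes does not depend on the `ℤ`-basis -/

section GramDet

variable {ι : Type*} [Fintype ι] [DecidableEq ι] {E : Type*} [NormedAddCommGroup E] [NormedSpace ℂ E]
  (Φ : (ι → ℝ) ≃L[ℝ] E) (e : Fin (2 + 2) ≃ ι) {κ : Type*} [Fintype κ] [DecidableEq κ]

omit [Fintype ι] [DecidableEq κ] in
/-- **The cup product `(x, y) ↦ ∫_X x ∧ y` expanded on two finite combinations**:
`∫ (∑ aₖ tₖ) ∧ (∑ b_l s_l) = ∑ₖ ∑_l aₖ b_l ∫ tₖ ∧ s_l` (bilinearity). [cite: ShiodaMitani1974, §1 (1.5)] -/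
theorem torusIntegral_sum_smul_wedge_sum_smul (t s : κ → E [⋀^Fin 2]→L[ℝ] ℂ) (a b : κ → ℂ) :
    torusIntegral Φ e ((∑ k, a k • t k).wedge (∑ l, b l • s l)) =
      ∑ k, ∑ l, a k * b l * torusIntegral Φ e ((t k).wedge (s l)) := by
  -- the pairing as a `ℂ`-bilinear map
  let B : (E [⋀^Fin 2]→L[ℝ] ℂ) →ₗ[ℂ] (E [⋀^Fin 2]→L[ℝ] ℂ) →ₗ[ℂ] ℂ :=
    LinearMap.mk₂ ℂ (fun x y ↦ torusIntegral Φ e (x.wedge y))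
      (fun x x' y ↦ by simp only [ContinuousAlternatingMap.wedge_add_left, torusIntegral_add])
      (fun c x y ↦ by
        simp only [Literature.LinearAlgebra.Alternating.wedge_smul_left_complex, torusIntegral_smul, smul_eq_mul])
      (fun x y y' ↦ by simp only [ContinuousAlternatingMap.wedge_add_right, torusIntegral_add])
      (fun c x y ↦ by
        simp only [Literature.LinearAlgebra.Alternating.wedge_smul_right_complex, torusIntegral_smul, smul_eq_mul])
  have hB : ∀ x y, torusIntegral Φ e (x.wedge y) = B x y := fun x y ↦ rfl
  simp only [hB, map_sum, map_smul, LinearMap.sum_apply, LinearMap.smul_apply, smul_eq_mul, Finset.mul_sum]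
  rw [Finset.sum_comm]
  refine Finset.sum_congr rfl fun k _ ↦ Finset.sum_congr rfl fun l _ ↦ ?_
  ring

omit [Fintype ι] in
/-- `n • t = (n : ℂ) • t` on invariant forms. [cite: Lange2023AbelianVarietiesComplex, §1.1.3 Cor. 1.1.19] -/
private theorem zsmul_eq_cast_smul₅ (n : ℤ) (t : E [⋀^Fin 2]→L[ℝ] ℂ) : n • t = (n : ℂ) • t :=
  (Int.cast_smul_eq_zsmul ℂ n t).symm

omit [Fintype ι] in
/-- A member of a family is the integer combination with coefficients `δᵢ`. [folklore] -/
private theorem eq_sum_single_smul (u : κ → E [⋀^Fin 2]→L[ℝ] ℂ) (i : κ) :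
    u i = ∑ k, (Pi.single i (1 : ℤ) : κ → ℤ) k • u k := by
  classical
  rw [Finset.sum_eq_single i (fun k _ hk ↦ by rw [Pi.single_eq_of_ne hk, zero_zsmul]) (by simp)]
  rw [Pi.single_eq_same, one_zsmul]

omit [Fintype ι] in
/-- **THE GRAM DETERMINANT OF A LATTICE OF `2`-CLASSES IS WELL DEFINED.**  If `T = ⊕ₖ ℤtₖ` (every element of `T`
is an integer combination of the `tₖ`, which are `ℂ`-independent) and `(uₖ)` is another family of the same size
generating `T` over `ℤ`, then the Gram matrices of `(uₖ)` and `(tₖ)` for the cup product `∫_X x ∧ y` have the same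
determinant: `u = Mt`, `t = M′u` with `M′M = 1` over `ℤ`, so `det M = ±1` and `det(M G ᵗM) = det G` — the
discriminants "`det T_X`", "`det NS_X`" of Shioda–Mitani and Ma are intrinsic.
[cite: ShiodaMitani1974, §1 (1.5)–(1.6) and §3 (3.19)–(3.21)] -/
theorem det_gram_eq_of_two_bases {T : AddSubgroup (E [⋀^Fin 2]→L[ℝ] ℂ)} {t u : κ → E [⋀^Fin 2]→L[ℝ] ℂ}
    (ht : ∀ x, x ∈ T ↔ ∃ n : κ → ℤ, x = ∑ k, n k • t k)
    (hti : ∀ c : κ → ℂ, ∑ k, c k • t k = 0 → ∀ k, c k = 0)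
    (hu : ∀ x, x ∈ T ↔ ∃ n : κ → ℤ, x = ∑ k, n k • u k) :
    (Matrix.of fun i j ↦ torusIntegral Φ e ((u i).wedge (u j))).det =
      (Matrix.of fun i j ↦ torusIntegral Φ e ((t i).wedge (t j))).det := by
  -- transition matrices `u = M t`, `t = M' u` over `ℤ`
  choose M hM using fun i ↦ (ht (u i)).1 ((hu (u i)).2 ⟨Pi.single i 1, eq_sum_single_smul u i⟩)
  choose M' hM' using fun i ↦ (hu (t i)).1 ((ht (t i)).2 ⟨Pi.single i 1, eq_sum_single_smul t i⟩)
  have hMu : ∀ i, u i = ∑ k, (M i k : ℂ) • t k := fun i ↦ by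
    rw [hM i]; simp only [zsmul_eq_cast_smul₅]
  have hMt : ∀ i, t i = ∑ j, (M' i j : ℂ) • u j := fun i ↦ by
    rw [hM' i]; simp only [zsmul_eq_cast_smul₅]
  -- `t_i = ∑_k (M'M)_{ik} t_k`, so `M'M = 1` by independence
  have expand : ∀ i, t i = ∑ k, (∑ j, (M' i j : ℂ) * (M j k : ℂ)) • t k := fun i ↦ by
    calc t i = ∑ j, (M' i j : ℂ) • u j := hMt i
      _ = ∑ j, ∑ k, ((M' i j : ℂ) * (M j k : ℂ)) • t k := by
          refine Finset.sum_congr rfl fun j _ ↦ ?_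
          rw [hMu j, Finset.smul_sum]
          exact Finset.sum_congr rfl fun k _ ↦ smul_smul _ _ _
      _ = ∑ k, ∑ j, ((M' i j : ℂ) * (M j k : ℂ)) • t k := Finset.sum_comm
      _ = ∑ k, (∑ j, (M' i j : ℂ) * (M j k : ℂ)) • t k :=
          Finset.sum_congr rfl fun k _ ↦ Finset.sum_smul.symm
  have hcoef : ∀ i k, ∑ j, (M' i j : ℂ) * (M j k : ℂ) = if i = k then 1 else 0 := fun i k ↦ by
    have h1 : ∑ k, ((∑ j, (M' i j : ℂ) * (M j k : ℂ)) - if i = k then (1 : ℂ) else 0) • t k =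
        ∑ k, (∑ j, (M' i j : ℂ) * (M j k : ℂ)) • t k - ∑ k, (if i = k then (1 : ℂ) else 0) • t k := by
      rw [← Finset.sum_sub_distrib]
      exact Finset.sum_congr rfl fun k _ ↦
        sub_smul (∑ j, (M' i j : ℂ) * (M j k : ℂ)) (if i = k then (1 : ℂ) else 0) (t k)
    have h2 : ∑ k, (if i = k then (1 : ℂ) else 0) • t k = t i := by
      rw [Finset.sum_eq_single i (fun k _ hk ↦ by rw [if_neg (Ne.symm hk)]; exact zero_smul ℂ (t k)) (by simp),
        if_pos rfl, one_smul]
    have hzero : ∑ k, ((∑ j, (M' i j : ℂ) * (M j k : ℂ)) - if i = k then (1 : ℂ) else 0) • t k = 0 := by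
      rw [h1, h2, ← expand i, sub_self]
    exact sub_eq_zero.1 (hti _ hzero k)
  have hPP : Matrix.of M' * Matrix.of M = (1 : Matrix κ κ ℤ) := by
    ext i k
    have h := hcoef i k
    rw [Matrix.mul_apply, Matrix.one_apply]
    simp only [Matrix.of_apply]
    split_ifs at h ⊢
    · exact_mod_cast h
    · exact_mod_cast h
  have hdetZ : (Matrix.of M').det * (Matrix.of M).det = 1 := by
    rw [← Matrix.det_mul, hPP, Matrix.det_one]
  have hdet_sq : (((Matrix.of M).det : ℤ) : ℂ) ^ 2 = 1 := by
    rcases Int.eq_one_or_neg_one_of_mul_eq_one' hdetZ with ⟨-, h1⟩ | ⟨-, h1⟩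
    · rw [h1]; norm_num
    · rw [h1]; norm_num
  -- the determinant of the cast matrix
  have hdetA : ((Matrix.of M).map (Int.cast : ℤ → ℂ)).det = (((Matrix.of M).det : ℤ) : ℂ) := by
    have h := RingHom.map_det (Int.castRingHom ℂ) (Matrix.of M)
    rw [RingHom.mapMatrix_apply, eq_intCast] at h
    rw [h]
    rfl
  -- `Gram(u) = A · Gram(t) · ᵗA` with `A` the cast of `M`
  have hGram : (Matrix.of fun i j ↦ torusIntegral Φ e ((u i).wedge (u j))) =
      (Matrix.of M).map (Int.cast : ℤ → ℂ) * (Matrix.of fun i j ↦ torusIntegral Φ e ((t i).wedge (t j))) *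
        ((Matrix.of M).map (Int.cast : ℤ → ℂ)).transpose := by
    ext i j
    rw [Matrix.of_apply, hMu i, hMu j, torusIntegral_sum_smul_wedge_sum_smul, Matrix.mul_apply]
    simp_rw [Matrix.mul_apply, Matrix.transpose_apply, Matrix.map_apply, Matrix.of_apply, Finset.sum_mul]
    rw [Finset.sum_comm]
    refine Finset.sum_congr rfl fun k _ ↦ Finset.sum_congr rfl fun l _ ↦ ?_
    ring
  rw [hGram, Matrix.det_mul, Matrix.det_mul, Matrix.det_transpose, hdetA]
  linear_combination (Matrix.of fun i j ↦ torusIntegral Φ e ((t i).wedge (t j))).det * hdet_sq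

end GramDet

/-! ## §2 Picard number `3`: "`2N = -det(T_X)`" and "`N = ½ det(NS_X)`" for EVERY `ℤ`-basis -/

section PicardThreeDet

variable {ι : Type*} [Fintype ι] [DecidableEq ι] {E : Type*} [NormedAddCommGroup E] [NormedSpace ℂ E]
  {Φ : (ι → ℝ) ≃L[ℝ] E}

omit [Fintype ι] [DecidableEq ι] in
/-- A three-generator description as a `Fin 3`-family description. [folklore] -/
private theorem mem_iff_exists_sum_fin_three {L : AddSubgroup (E [⋀^Fin 2]→L[ℝ] ℂ)} {u₁ u₂ u₃ : E [⋀^Fin 2]→L[ℝ] ℂ}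
    (h : ∀ t, t ∈ L ↔ ∃ n₁ n₂ n₃ : ℤ, t = n₁ • u₁ + n₂ • u₂ + n₃ • u₃) (t : E [⋀^Fin 2]→L[ℝ] ℂ) :
    t ∈ L ↔ ∃ n : Fin 3 → ℤ, t = ∑ k, n k • ![u₁, u₂, u₃] k := by
  rw [h t]
  constructor
  · rintro ⟨n₁, n₂, n₃, rfl⟩
    exact ⟨![n₁, n₂, n₃], by simp [Fin.sum_univ_three]⟩
  · rintro ⟨n, rfl⟩
    exact ⟨n 0, n 1, n 2, by simp [Fin.sum_univ_three]⟩

omit [Fintype ι] [DecidableEq ι] in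
/-- `ℂ`-independence of a triple as independence of the `Fin 3`-family. [folklore] -/
private theorem forall_eq_zero_fin_three {u₁ u₂ u₃ : E [⋀^Fin 2]→L[ℝ] ℂ}
    (h : ∀ n₁ n₂ n₃ : ℂ, n₁ • u₁ + n₂ • u₂ + n₃ • u₃ = 0 → n₁ = 0 ∧ n₂ = 0 ∧ n₃ = 0)
    (c : Fin 3 → ℂ) (hc : ∑ k, c k • ![u₁, u₂, u₃] k = 0) (k : Fin 3) : c k = 0 := by
  rw [Fin.sum_univ_three] at hc
  simp only [Matrix.cons_val_zero, Matrix.cons_val_one, Matrix.cons_val] at hc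
  obtain ⟨h0, h1, h2⟩ := h _ _ _ hc
  fin_cases k
  · exact h0
  · exact h1
  · exact h2

omit [Fintype ι] in
/-- The determinant of a Gram matrix `((0,1,0),(1,0,0),(0,0,m))` given by its upper triangle (the cup product on
`2`-classes is symmetric). [cite: Ma2011DecompositionsAbelianSurface, §4.1 (4.1)] -/
private theorem det_gram_fin_three (e : Fin (2 + 2) ≃ ι) {u₁ u₂ u₃ : E [⋀^Fin 2]→L[ℝ] ℂ} {m : ℂ}
    (g11 : torusIntegral Φ e (u₁.wedge u₁) = 0) (g12 : torusIntegral Φ e (u₁.wedge u₂) = 1)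
    (g13 : torusIntegral Φ e (u₁.wedge u₃) = 0) (g22 : torusIntegral Φ e (u₂.wedge u₂) = 0)
    (g23 : torusIntegral Φ e (u₂.wedge u₃) = 0) (g33 : torusIntegral Φ e (u₃.wedge u₃) = m) :
    (Matrix.of fun i j ↦ torusIntegral Φ e ((![u₁, u₂, u₃] i).wedge (![u₁, u₂, u₃] j))).det = -m := by
  have g21 : torusIntegral Φ e (u₂.wedge u₁) = 1 := (torusIntegral_wedge_two_comm Φ e u₂ u₁).trans g12
  have g31 : torusIntegral Φ e (u₃.wedge u₁) = 0 := (torusIntegral_wedge_two_comm Φ e u₃ u₁).trans g13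
  have g32 : torusIntegral Φ e (u₃.wedge u₂) = 0 := (torusIntegral_wedge_two_comm Φ e u₃ u₂).trans g23
  rw [Matrix.det_fin_three]
  simp only [Matrix.of_apply, Matrix.cons_val_zero, Matrix.cons_val_one, Matrix.cons_val]
  rw [g11, g12, g13, g21, g22, g23, g31, g32, g33]
  ring

/-- **MA'S "`2N = -det(T_A)`" AND "`N = ½ det(NS_A)`" ARE INTRINSIC.**  For every decomposable two-dimensional
complex torus `X ≅ E_{τ₁} × E_{τ₂}` with `ρ(X) = 3` there is `N ≥ 1` — the minimal degree of an isogeny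
`E_{τ₁} → E_{τ₂}` (every isogeny has degree divisible by and at least `N`, and `N` is attained; Prop. 4.1) — such
that EVERY `ℤ`-basis `(u₀, u₁, u₂)` of the transcendental lattice `T_X` has Gram determinant `det(∫ uᵢ ∧ uⱼ) = -2N`
and EVERY `ℤ`-basis `(v₀, v₁, v₂)` of the Néron–Severi lattice `NS_X = H²(X, ℤ) ∩ H^{1,1}` has Gram determinant
`2N` (Ma's (4.1) `N = ½ det(NS_A) = -½ det(T_A)`, independent of the basis).
[cite: Ma2011DecompositionsAbelianSurface, §4.1 (4.1) and Prop. 4.1] -/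
theorem det_gram_transcendentalLattice_neronSeveri_of_finrank_eq_three (e : Fin (2 + 2) ≃ ι)
    (hρ : finrank ℤ (neronSeveriGroup Φ) = 3) {τ₁ τ₂ : ℂ} (hτ₁ : 0 < τ₁.im) (hτ₂ : 0 < τ₂.im)
    (h : IsIsomorphic (prodPeriod (ellipticPeriod hτ₁.ne') (ellipticPeriod hτ₂.ne')) Φ) :
    ∃ N : ℕ, 0 < N ∧
      ((∀ A : Matrix (Fin 2) (Fin 2) ℤ, IsIsogeny (ellipticPeriod hτ₁.ne') (ellipticPeriod hτ₂.ne') A →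
          N ∣ Nat.card (mapMatrixHom (ellipticPeriod hτ₁.ne') (ellipticPeriod hτ₂.ne') A).ker ∧
            N ≤ Nat.card (mapMatrixHom (ellipticPeriod hτ₁.ne') (ellipticPeriod hτ₂.ne') A).ker) ∧
        ∃ A : Matrix (Fin 2) (Fin 2) ℤ, IsIsogeny (ellipticPeriod hτ₁.ne') (ellipticPeriod hτ₂.ne') A ∧
          Nat.card (mapMatrixHom (ellipticPeriod hτ₁.ne') (ellipticPeriod hτ₂.ne') A).ker = N) ∧
      (∀ u : Fin 3 → E [⋀^Fin 2]→L[ℝ] ℂ,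
        (∀ t, t ∈ transcendentalLattice Φ ↔ ∃ n : Fin 3 → ℤ, t = ∑ k, n k • u k) →
          (Matrix.of fun i j ↦ torusIntegral Φ e ((u i).wedge (u j))).det = -(2 * (N : ℂ))) ∧
      ∀ v : Fin 3 → E [⋀^Fin 2]→L[ℝ] ℂ,
        (∀ s, s ∈ integralHodgeClasses Φ 1 ↔ ∃ n : Fin 3 → ℤ, s = ∑ k, n k • v k) →
          (Matrix.of fun i j ↦ torusIntegral Φ e ((v i).wedge (v j))).det = 2 * (N : ℂ) := by
  obtain ⟨N, hN, ⟨v₁, v₂, v₃, hSmem, hSind, s11, s12, s13, s22, s23, s33⟩,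
    ⟨u₁, u₂, u₃, hTmem, hTind, t11, t12, t13, t22, t23, t33⟩, hmin⟩ :=
    neronSeveri_transcendental_gram_of_finrank_eq_three e hρ hτ₁ hτ₂ h
  refine ⟨N, hN, hmin, fun u hu ↦ ?_, fun v hv ↦ ?_⟩
  · rw [det_gram_eq_of_two_bases Φ e (mem_iff_exists_sum_fin_three hTmem) (forall_eq_zero_fin_three hTind) hu,
      det_gram_fin_three e t11 t12 t13 t22 t23 t33]
  · rw [det_gram_eq_of_two_bases Φ e (mem_iff_exists_sum_fin_three hSmem) (forall_eq_zero_fin_three hSind) hv,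
      det_gram_fin_three e s11 s12 s13 s22 s23 s33]
    ring

end PicardThreeDet

end ComplexTorus

end Literature.Geometry.Kaehler

end
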